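import Mathlib
import Summits.Ventures.PercRepro2.UnionRowMech2
import Summits.Ventures.PercRepro2.UnionRowMech3

/-!
# The two-status union row from conditional positive association — the residual patterns, II
(blind cell PercRepro2, mine-1 g40; proofs/MINE1-UNIONROW2.md §8)

The three mechanisms of `UnionRowMech3` as real arithmetic — `patG` (from `σ′·Q ≤ P·(Z − Q)`),
`patH` (from `(Q − P)·P ≤ (P − σ)·(Z − P)`), `patK` (`A = {u = S}`, `B = {u ≠ T}`) — the
standing facts `P ≤ Q ≤ Z`, `σ ≤ P`, `σ′ ≤ Z − Q` for `A = resUp cA ⊆ B = resUp cB`, and the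
six cases (G) of the residual pattern `(S, T) ∈ A ∩ B`, `(T, S) ∉ A ∪ B`: `cA ≤ 2`
(`(N, S) ∈ A`), `cB ≤ cA`, each from ONE instance of `hR′` — positive association of down-sets
inside `{u ≠ S}` (`s ↮ {t, u}`) — on `Bᶜ` and `{u ≠ S, v < cA}`.
-/

namespace Summit.Ventures.PercRepro2

namespace UnionRowMech

open Finset

variable {M : Grid → ℝ}

/-! ### The three mechanisms, as real arithmetic -/

/-- Mechanism (G): from `σ′·Q ≤ P·(Z − Q)`. -/
lemma patG {P Q Z σ σ' : ℝ} (hσ : 0 ≤ σ) (hσP : σ ≤ P) (hPQ : P ≤ Q) (hQZ : Q ≤ Z)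
    (hkey : σ' * Q ≤ P * (Z - Q)) :
    0 ≤ Z * (Z * P - P * Q) - σ * (Z - P) * (Z - Q) - σ' * P * Q := by
  have h1 : 0 ≤ (P - σ) * (Z - P) * (Z - Q) :=
    mul_nonneg (mul_nonneg (by linarith) (by linarith)) (by linarith)
  have h2 : 0 ≤ P * (P * (Z - Q) - σ' * Q) := mul_nonneg (by linarith) (by linarith)
  nlinarith [h1, h2]

/-- Mechanism (H): from `(Q − P)·P ≤ (P − σ)·(Z − P)`. -/
lemma patH {P Q Z σ σ' : ℝ} (hP : 0 ≤ P) (hPQ : P ≤ Q) (hQZ : Q ≤ Z) (hσ'Q : σ' ≤ Z - Q)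
    (hkey : (Q - P) * P ≤ (P - σ) * (Z - P)) :
    0 ≤ Z * (Z * P - P * Q) - σ * (Z - P) * (Z - Q) - σ' * P * Q := by
  have h1 : 0 ≤ (Z - Q) * ((P - σ) * (Z - P) - (Q - P) * P) :=
    mul_nonneg (by linarith) (by linarith)
  have h2 : 0 ≤ (Z - Q - σ') * P * Q := mul_nonneg (mul_nonneg (by linarith) hP) (by linarith)
  nlinarith [h1, h2]

/-- Mechanism (K): `A = {u = S}`, `B = {u ≠ T}`; `a = ā + σ`, `τ = τ̄ + σ′`, `n = x + y + w`
(`x = M(N,T)`, `y = M(N,N)`, `w = M(N,S)`), from `a·(y + w) ≤ ā·n` and `τ·(x + y) ≤ τ̄·n`. -/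
lemma patK {ab σ tb σ' x y w : ℝ} (hab : 0 ≤ ab) (hσ : 0 ≤ σ) (htb : 0 ≤ tb) (hσ' : 0 ≤ σ')
    (hy : 0 ≤ y)
    (h1 : (ab + σ) * (y + w) ≤ ab * (x + y + w))
    (h2 : (tb + σ') * (x + y) ≤ tb * (x + y + w)) :
    0 ≤ (ab + σ + (x + y + w) + (tb + σ')) *
        ((ab + σ + (x + y + w) + (tb + σ')) * (ab + σ) - (ab + σ) * (ab + σ + (x + y + w))) -
      σ * ((ab + σ + (x + y + w) + (tb + σ')) - (ab + σ)) *
        ((ab + σ + (x + y + w) + (tb + σ')) - (ab + σ + (x + y + w))) -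
      σ' * (ab + σ) * (ab + σ + (x + y + w)) := by
  have ha : 0 ≤ ab + σ := by linarith
  have ht : 0 ≤ tb + σ' := by linarith
  have h3 := mul_le_mul_of_nonneg_left h1 ht
  have h4 := mul_le_mul_of_nonneg_left h2 ha
  have h5 : 0 ≤ ab * (tb + σ') * (tb + σ') := by positivity
  have h6 : 0 ≤ tb * (ab + σ) * (ab + σ) := by positivity
  have h7 : 0 ≤ (ab + σ) * (tb + σ') * y := by positivity
  nlinarith [h3, h4, h5, h6, h7]

/-! ### The residual pattern (ii) -/

/-- `(T, S)` lies outside `resUp c`: `M(T,S) ≤ Z − M(resUp c)`. -/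
lemma TS_le_compl_resUp (hM : ∀ k, 0 ≤ M k) (c : ℕ) (hc : c ≤ 3) :
    M TS ≤ total M - mass M (resUp c) := by
  have h := mass_compl (M := M) (resUp c)
  have h2 : M TS ≤ mass M (Finset.univ \ resUp c) := by
    unfold mass
    refine Finset.single_le_sum (fun k _ => hM k) ?_
    interval_cases c <;> decide
  linarith

/-- `(S, T)` lies inside `resUp c`: `M(S,T) ≤ M(resUp c)`. -/
lemma ST_le_resUp (hM : ∀ k, 0 ≤ M k) (c : ℕ) (hc : c ≤ 3) : M ST ≤ mass M (resUp c) := by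
  unfold mass
  refine Finset.single_le_sum (fun k _ => hM k) ?_
  interval_cases c <;> decide

/-- The nine cell masses are nonnegative. -/
lemma cells_nonneg (hM : ∀ k, 0 ≤ M k) :
    0 ≤ M (0,0) ∧ 0 ≤ M (0,1) ∧ 0 ≤ M (0,2) ∧ 0 ≤ M (1,0) ∧ 0 ≤ M (1,1) ∧ 0 ≤ M (1,2) ∧
      0 ≤ M (2,0) ∧ 0 ≤ M (2,1) ∧ 0 ≤ M (2,2) :=
  ⟨hM _, hM _, hM _, hM _, hM _, hM _, hM _, hM _, hM _⟩

/-- The standing facts for `A = resUp cA ⊆ B = resUp cB`: `P ≤ Q ≤ Z`, `σ ≤ P`, `σ′ ≤ Z − Q`. -/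
lemma resUp_facts (hM : ∀ k, 0 ≤ M k) {cA cB : ℕ} (hcA : cA ≤ 3) (hcB : cB ≤ cA) :
    mass M (resUp cA) ≤ mass M (resUp cB) ∧ mass M (resUp cB) ≤ total M ∧
      M ST ≤ mass M (resUp cA) ∧ M TS ≤ total M - mass M (resUp cB) :=
  ⟨Finset.sum_le_sum_of_subset_of_nonneg (resUp_subset_resUp hcB) fun k _ _ => hM k,
    mass_le_total hM _, ST_le_resUp hM cA hcA, TS_le_compl_resUp hM cB (le_trans hcB hcA)⟩

/-- The residual pattern (ii) for `(cA, cB) = (0, 0)`. -/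
lemma residual_case_0_0 (hM : ∀ k, 0 ≤ M k)
    (hR' : ∀ A B : Finset Grid, IsDown A → IsDown B → A ⊆ R' → B ⊆ R' →
      mass M A * mass M B ≤ mass M (A ∩ B) * mass M R')
    :
    0 ≤ total M * (total M * mass M (resUp 0) - mass M (resUp 0) * mass M (resUp 0)) -
      M ST * (total M - mass M (resUp 0)) * (total M - mass M (resUp 0)) -
      M TS * mass M (resUp 0) * mass M (resUp 0) := by
  obtain ⟨h00, h01, h02, h10, h11, h12, h20, h21, h22⟩ := cells_nonneg hM
  obtain ⟨hPQ, hQZ, hσP, -⟩ := resUp_facts hM (cA := 0) (cB := 0) (by norm_num) (by norm_num)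
  have hσ := hM ST
  -- mechanism (G)
  have e := hR' _ _ (isDown_compl (isUp_resUp 0 (by norm_num))) (isDown_Dset 0 (by norm_num))
    (compl_resUp_subset_R' 0) (Dset_subset_R' 0)
  rw [mass_compl_resUp_0, mass_Dset_0, mass_inter_G_0_0, mass_R'_expand] at e
  refine patG hσ hσP hPQ hQZ ?_
  rw [mass_resUp_0, total_expand]
  unfold TS
  have hp1 : (M (1,0) + M (1,1) + M (1,2)) * (0) ≤ (M (1,0) + M (1,1) + M (1,2)) * (M (0,0) + M (0,1) + M (0,2) - M (0,2)) :=
    mul_le_mul_of_nonneg_left (by linarith) (by linarith)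
  have hp2 : (M (2,0) + M (2,1) + M (2,2)) * M (0,2) ≤ (M (2,0) + M (2,1) + M (2,2)) * (M (0,0) + M (0,1) + M (0,2)) :=
    mul_le_mul_of_nonneg_left (by linarith) (by linarith)
  have hp3 : 0 ≤ (M (2,0) + M (2,1) + M (2,2)) * (0) := mul_nonneg (by linarith) (by linarith)
  nlinarith [e, hp1, hp2, hp3]

/-- The residual pattern (ii) for `(cA, cB) = (1, 0)`. -/
lemma residual_case_1_0 (hM : ∀ k, 0 ≤ M k)
    (hR' : ∀ A B : Finset Grid, IsDown A → IsDown B → A ⊆ R' → B ⊆ R' →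
      mass M A * mass M B ≤ mass M (A ∩ B) * mass M R')
    :
    0 ≤ total M * (total M * mass M (resUp 1) - mass M (resUp 1) * mass M (resUp 0)) -
      M ST * (total M - mass M (resUp 1)) * (total M - mass M (resUp 0)) -
      M TS * mass M (resUp 1) * mass M (resUp 0) := by
  obtain ⟨h00, h01, h02, h10, h11, h12, h20, h21, h22⟩ := cells_nonneg hM
  obtain ⟨hPQ, hQZ, hσP, -⟩ := resUp_facts hM (cA := 1) (cB := 0) (by norm_num) (by norm_num)
  have hσ := hM ST
  -- mechanism (G)
  have e := hR' _ _ (isDown_compl (isUp_resUp 0 (by norm_num))) (isDown_Dset 1 (by norm_num))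
    (compl_resUp_subset_R' 0) (Dset_subset_R' 1)
  rw [mass_compl_resUp_0, mass_Dset_1, mass_inter_G_1_0, mass_R'_expand] at e
  refine patG hσ hσP hPQ hQZ ?_
  rw [mass_resUp_1, mass_resUp_0, total_expand]
  unfold TS
  have hp1 : (M (1,0) + M (1,1) + M (1,2)) * (M (0,0)) ≤ (M (1,0) + M (1,1) + M (1,2)) * (M (0,0) + M (0,1) + M (0,2) - M (0,2)) :=
    mul_le_mul_of_nonneg_left (by linarith) (by linarith)
  have hp2 : (M (2,0) + M (2,1) + M (2,2)) * M (0,2) ≤ (M (2,0) + M (2,1) + M (2,2)) * (M (0,0) + M (0,1) + M (0,2)) :=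
    mul_le_mul_of_nonneg_left (by linarith) (by linarith)
  have hp3 : 0 ≤ (M (2,0) + M (2,1) + M (2,2)) * (0) := mul_nonneg (by linarith) (by linarith)
  nlinarith [e, hp1, hp2, hp3]

/-- The residual pattern (ii) for `(cA, cB) = (1, 1)`. -/
lemma residual_case_1_1 (hM : ∀ k, 0 ≤ M k)
    (hR' : ∀ A B : Finset Grid, IsDown A → IsDown B → A ⊆ R' → B ⊆ R' →
      mass M A * mass M B ≤ mass M (A ∩ B) * mass M R')
    :
    0 ≤ total M * (total M * mass M (resUp 1) - mass M (resUp 1) * mass M (resUp 1)) -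
      M ST * (total M - mass M (resUp 1)) * (total M - mass M (resUp 1)) -
      M TS * mass M (resUp 1) * mass M (resUp 1) := by
  obtain ⟨h00, h01, h02, h10, h11, h12, h20, h21, h22⟩ := cells_nonneg hM
  obtain ⟨hPQ, hQZ, hσP, -⟩ := resUp_facts hM (cA := 1) (cB := 1) (by norm_num) (by norm_num)
  have hσ := hM ST
  -- mechanism (G)
  have e := hR' _ _ (isDown_compl (isUp_resUp 1 (by norm_num))) (isDown_Dset 1 (by norm_num))
    (compl_resUp_subset_R' 1) (Dset_subset_R' 1)
  rw [mass_compl_resUp_1, mass_Dset_1, mass_inter_G_1_1, mass_R'_expand] at e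
  refine patG hσ hσP hPQ hQZ ?_
  rw [mass_resUp_1, total_expand]
  unfold TS
  have hp1 : (M (1,1) + M (1,2)) * (M (0,0)) ≤ (M (1,1) + M (1,2)) * (M (0,0) + M (0,1) + M (0,2) - M (0,2)) :=
    mul_le_mul_of_nonneg_left (by linarith) (by linarith)
  have hp2 : (M (2,0) + M (2,1) + M (2,2)) * M (0,2) ≤ (M (2,0) + M (2,1) + M (2,2)) * (M (0,0) + M (0,1) + M (0,2)) :=
    mul_le_mul_of_nonneg_left (by linarith) (by linarith)
  have hp3 : 0 ≤ (M (2,0) + M (2,1) + M (2,2)) * (M (1,0)) := mul_nonneg (by linarith) (by linarith)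
  nlinarith [e, hp1, hp2, hp3]

/-- The residual pattern (ii) for `(cA, cB) = (2, 0)`. -/
lemma residual_case_2_0 (hM : ∀ k, 0 ≤ M k)
    (hR' : ∀ A B : Finset Grid, IsDown A → IsDown B → A ⊆ R' → B ⊆ R' →
      mass M A * mass M B ≤ mass M (A ∩ B) * mass M R')
    :
    0 ≤ total M * (total M * mass M (resUp 2) - mass M (resUp 2) * mass M (resUp 0)) -
      M ST * (total M - mass M (resUp 2)) * (total M - mass M (resUp 0)) -
      M TS * mass M (resUp 2) * mass M (resUp 0) := by
  obtain ⟨h00, h01, h02, h10, h11, h12, h20, h21, h22⟩ := cells_nonneg hM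
  obtain ⟨hPQ, hQZ, hσP, -⟩ := resUp_facts hM (cA := 2) (cB := 0) (by norm_num) (by norm_num)
  have hσ := hM ST
  -- mechanism (G)
  have e := hR' _ _ (isDown_compl (isUp_resUp 0 (by norm_num))) (isDown_Dset 2 (by norm_num))
    (compl_resUp_subset_R' 0) (Dset_subset_R' 2)
  rw [mass_compl_resUp_0, mass_Dset_2, mass_inter_G_2_0, mass_R'_expand] at e
  refine patG hσ hσP hPQ hQZ ?_
  rw [mass_resUp_2, mass_resUp_0, total_expand]
  unfold TS
  have hp1 : (M (1,0) + M (1,1) + M (1,2)) * (M (0,0) + M (0,1)) ≤ (M (1,0) + M (1,1) + M (1,2)) * (M (0,0) + M (0,1) + M (0,2) - M (0,2)) :=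
    mul_le_mul_of_nonneg_left (by linarith) (by linarith)
  have hp2 : (M (2,0) + M (2,1) + M (2,2)) * M (0,2) ≤ (M (2,0) + M (2,1) + M (2,2)) * (M (0,0) + M (0,1) + M (0,2)) :=
    mul_le_mul_of_nonneg_left (by linarith) (by linarith)
  have hp3 : 0 ≤ (M (2,0) + M (2,1) + M (2,2)) * (0) := mul_nonneg (by linarith) (by linarith)
  nlinarith [e, hp1, hp2, hp3]

/-- The residual pattern (ii) for `(cA, cB) = (2, 1)`. -/
lemma residual_case_2_1 (hM : ∀ k, 0 ≤ M k)
    (hR' : ∀ A B : Finset Grid, IsDown A → IsDown B → A ⊆ R' → B ⊆ R' →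
      mass M A * mass M B ≤ mass M (A ∩ B) * mass M R')
    :
    0 ≤ total M * (total M * mass M (resUp 2) - mass M (resUp 2) * mass M (resUp 1)) -
      M ST * (total M - mass M (resUp 2)) * (total M - mass M (resUp 1)) -
      M TS * mass M (resUp 2) * mass M (resUp 1) := by
  obtain ⟨h00, h01, h02, h10, h11, h12, h20, h21, h22⟩ := cells_nonneg hM
  obtain ⟨hPQ, hQZ, hσP, -⟩ := resUp_facts hM (cA := 2) (cB := 1) (by norm_num) (by norm_num)
  have hσ := hM ST
  -- mechanism (G)
  have e := hR' _ _ (isDown_compl (isUp_resUp 1 (by norm_num))) (isDown_Dset 2 (by norm_num))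
    (compl_resUp_subset_R' 1) (Dset_subset_R' 2)
  rw [mass_compl_resUp_1, mass_Dset_2, mass_inter_G_2_1, mass_R'_expand] at e
  refine patG hσ hσP hPQ hQZ ?_
  rw [mass_resUp_2, mass_resUp_1, total_expand]
  unfold TS
  have hp1 : (M (1,1) + M (1,2)) * (M (0,0) + M (0,1)) ≤ (M (1,1) + M (1,2)) * (M (0,0) + M (0,1) + M (0,2) - M (0,2)) :=
    mul_le_mul_of_nonneg_left (by linarith) (by linarith)
  have hp2 : (M (2,0) + M (2,1) + M (2,2)) * M (0,2) ≤ (M (2,0) + M (2,1) + M (2,2)) * (M (0,0) + M (0,1) + M (0,2)) :=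
    mul_le_mul_of_nonneg_left (by linarith) (by linarith)
  have hp3 : 0 ≤ (M (2,0) + M (2,1) + M (2,2)) * (M (1,0)) := mul_nonneg (by linarith) (by linarith)
  nlinarith [e, hp1, hp2, hp3]

/-- The residual pattern (ii) for `(cA, cB) = (2, 2)`. -/
lemma residual_case_2_2 (hM : ∀ k, 0 ≤ M k)
    (hR' : ∀ A B : Finset Grid, IsDown A → IsDown B → A ⊆ R' → B ⊆ R' →
      mass M A * mass M B ≤ mass M (A ∩ B) * mass M R')
    :
    0 ≤ total M * (total M * mass M (resUp 2) - mass M (resUp 2) * mass M (resUp 2)) -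
      M ST * (total M - mass M (resUp 2)) * (total M - mass M (resUp 2)) -
      M TS * mass M (resUp 2) * mass M (resUp 2) := by
  obtain ⟨h00, h01, h02, h10, h11, h12, h20, h21, h22⟩ := cells_nonneg hM
  obtain ⟨hPQ, hQZ, hσP, -⟩ := resUp_facts hM (cA := 2) (cB := 2) (by norm_num) (by norm_num)
  have hσ := hM ST
  -- mechanism (G)
  have e := hR' _ _ (isDown_compl (isUp_resUp 2 (by norm_num))) (isDown_Dset 2 (by norm_num))
    (compl_resUp_subset_R' 2) (Dset_subset_R' 2)
  rw [mass_compl_resUp_2, mass_Dset_2, mass_inter_G_2_2, mass_R'_expand] at e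
  refine patG hσ hσP hPQ hQZ ?_
  rw [mass_resUp_2, total_expand]
  unfold TS
  have hp1 : (M (1,2)) * (M (0,0) + M (0,1)) ≤ (M (1,2)) * (M (0,0) + M (0,1) + M (0,2) - M (0,2)) :=
    mul_le_mul_of_nonneg_left (by linarith) (by linarith)
  have hp2 : (M (2,0) + M (2,1) + M (2,2)) * M (0,2) ≤ (M (2,0) + M (2,1) + M (2,2)) * (M (0,0) + M (0,1) + M (0,2)) :=
    mul_le_mul_of_nonneg_left (by linarith) (by linarith)
  have hp3 : 0 ≤ (M (2,0) + M (2,1) + M (2,2)) * (M (1,0) + M (1,1)) := mul_nonneg (by linarith) (by linarith)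
  nlinarith [e, hp1, hp2, hp3]

/-- The residual pattern (ii) for `(cA, cB) = (3, 0)`. -/
lemma residual_case_3_0 (hM : ∀ k, 0 ≤ M k)
    (hRu : ∀ A B : Finset Grid, IsUp A → IsUp B → A ⊆ Ru → B ⊆ Ru →
      mass M A * mass M B ≤ mass M (A ∩ B) * mass M Ru)
    (hR' : ∀ A B : Finset Grid, IsDown A → IsDown B → A ⊆ R' → B ⊆ R' →
      mass M A * mass M B ≤ mass M (A ∩ B) * mass M R')
    :
    0 ≤ total M * (total M * mass M (resUp 3) - mass M (resUp 3) * mass M (resUp 0)) -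
      M ST * (total M - mass M (resUp 3)) * (total M - mass M (resUp 0)) -
      M TS * mass M (resUp 3) * mass M (resUp 0) := by
  obtain ⟨h00, h01, h02, h10, h11, h12, h20, h21, h22⟩ := cells_nonneg hM
  -- mechanism (K)
  have e1 := hRu _ _ (isUp_resUp 3 (by norm_num)) (isUp_Cset 1 (by norm_num))
    (resUp_subset_Ru 3) (Cset_subset_Ru 1)
  rw [mass_resUp_3, mass_Cset_1, mass_inter_H_1, mass_Ru_expand] at e1
  have e2 := hR' _ _ isDown_rowT (isDown_Dset 2 (by norm_num)) rowT_subset_R' (Dset_subset_R' 2)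
  rw [mass_rowT, mass_Dset_2, mass_inter_K2, mass_R'_expand] at e2
  rw [mass_resUp_3, mass_resUp_0, total_expand]
  unfold ST TS
  have key := patK (ab := M (2,1) + M (2,2)) (σ := M (2,0)) (tb := M (0,0) + M (0,1))
    (σ' := M (0,2)) (x := M (1,0)) (y := M (1,1)) (w := M (1,2)) (by linarith) h20 (by linarith) h02
    h11 (by linarith) (by linarith)
  nlinarith [key]

end UnionRowMech

end Summit.Ventures.PercRepro2
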